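/-
Copyright (c) 2026. All rights reserved.
Released under Apache 2.0 license as described in the file LICENSE.
-/
import Summits.HodgeConjecture.HodgeConjecture.Theorems.K2LiuLocalSWBigCellContraction -- ★ F3c-B3 `continuous_nElem` (+ ★ F3c-A/B1/B2, ★ `continuous_matA`)
import HarnessLib

/-!
# Crux `HLiu418`, #42S organ S1, ROAD W, file F3c-B4: THE BIG-CELL COORDINATE `ν` (the `hνc`/`hν` binders of ★ `spanning_criterion`)

Cell `hodgecm-mathlib`, crux item hLiu418 = `stmt-HodgeConjecture-24832`; squad K2 ∕ K2Liu; prover K2Liu-p06 (g4), the dedicated S1 hand.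
THEOREMS ONLY (no `def`, no instance, no notation, no named-fact hypothesis, no `sorry`); lane `--supports stmt-HodgeConjecture-24832 --as helper`.

★ F3b `spanning_criterion` asks for a map `ν : H_v → H_v`, continuous on the big cell `Ω = P_Δ w_Δ N_Δ`, with `ν(p w_Δ u) = u`.  By ★ F3c-A the big cell is
`{g : C(g) invertible}` (`C` the adapted lower-left block) and the `N_Δ`-coordinate of `g = p w_Δ u` is `u = n(C(g)⁻¹ D(g))` (★ `nElem_blkCInv_mul_blkD_eq`); so
`ν(g) := n(C(g)⁻¹ D(g))` on `Ω` (and `1` off `Ω`) works, and its continuity on `Ω` is that of `g ↦ C(g)⁻¹ D(g)` there — checked place by place above `v`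
(`C ↦ C⁻¹ = det(C)⁻¹ • adj C` is continuous on the invertible matrices over each local FIELD `E_w`) — composed with ★ F3c-B3 `continuous_nElem`.
* §1 `map_nonsing_inv_of_isUnit_det` (ring maps commute with `⁻¹` on invertible matrices), `continuous_blkC_matA`, `continuous_blkD_matA`,
  `continuousOn_blkCInv_mul_blkD` (on `{C(g) invertible}`).
* §2 **`exists_bigCell_coordinate`**: `∃ ν`, `ContinuousOn ν Ω` and `ν (p w_Δ u) = u` for `p ∈ P_Δ`, `u ∈ N_Δ` — the `hνc`/`hν` binders of ★ `spanning_criterion` BY VALUE,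
  in GR91 local currency (`P_Δ`-membership as ★ `IsSiegelDelta`; the K2Liu CM assembly converts with ★ `mem_siegelDeltaLoc_iff_local`).
References: [BernsteinZelevinsky1976] §1.5; [Kudla1994] §3; [HarrisKudlaSweet1996] §1 (1.11); [MoeglinVignerasWaldspurger1987] Chap. 2 II.8.
HONEST LABEL.  Count-neutral helper: `HC_CM` is proved only modulo the 7 printed citations (2 remaining named inputs: hLiu418 = `stmt-HodgeConjecture-24832`,
h413 = `stmt-HodgeConjecture-24833`) until rung 0 closes.
-/

set_option autoImplicit false
set_option linter.dupNamespace false -- the mandated namespace repeats `HodgeConjecture.HodgeConjecture`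

noncomputable section

open NumberField IsDedekindDomain Matrix
open Literature.NumberTheory.Automorphic Literature.NumberTheory.Automorphic.UnitaryGroup
open Literature.NumberTheory.GelbartRogawski1991.AdaptedBlocks
open Literature.NumberTheory.GelbartRogawski1991.UnitaryDualPair.LocalSplitting
open Literature.NumberTheory.K2Lit.LocalSiegelDoubled
open Summit.HodgeConjecture.HodgeConjecture.Cruxes.HLiu418.K2LiuLocalSWBigCellDecomposition
open Summit.HodgeConjecture.HodgeConjecture.Cruxes.HLiu418.K2LiuLocalSWBigCellTopology
open Summit.HodgeConjecture.HodgeConjecture.Cruxes.HLiu418.K2LiuLocalSWBigCellContraction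
open Summit.HodgeConjecture.HodgeConjecture.Cruxes.HLiu418.K2LiuUnipDeltaRankOneHaar

namespace Summit.HodgeConjecture.HodgeConjecture.Cruxes.HLiu418.K2LiuLocalSWBigCellCoordinate

variable (F : Type) [Field F] [NumberField F] (E : Type) [Field E] [NumberField E] [Algebra F E]
  (c : E ≃ₐ[F] E)
  {δ : E} (hcδ : c δ = -δ) (hδ : δ ≠ 0) {d : F} (hd : δ * δ = algebraMap F E d)
  (v : HeightOneSpectrum (𝓞 F)) (n : ℕ) {T₀ : Matrix (Fin n) (Fin n) F} (hT₀ : T₀.IsSymm) (hT₀d : IsUnit T₀.det)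
  {JD : Matrix (Fin (n + n)) (Fin (n + n)) E} (hJD : JD = (gramD F n T₀).map (algebraMap F E))

/-! ## §1 Continuity of `g ↦ C(g)⁻¹ D(g)` on the big cell -/

/-- Ring homomorphisms commute with the matrix inverse on invertible matrices. [folklore] -/
theorem map_nonsing_inv_of_isUnit_det {R S : Type*} [CommRing R] [CommRing S] {m : Type*} [Fintype m] [DecidableEq m] (f : R →+* S)
    {C : Matrix m m R} (hC : IsUnit C.det) : (C⁻¹).map f = (C.map f)⁻¹ := by
  symm
  refine Matrix.inv_eq_left_inv ?_
  rw [← Matrix.map_mul, Matrix.nonsing_inv_mul _ hC, Matrix.map_one _ (map_zero f) (map_one f)]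

/-- `g ↦ C(g)` (the adapted lower-left block) is continuous. [cite: MoeglinVignerasWaldspurger1987, Chap. 2 II.8] -/
theorem continuous_blkC_matA : Continuous fun g : UnitaryGroup.localPi E c (n + n) JD v => blkC (matA F E c v n g) := by
  have h : (fun g : UnitaryGroup.localPi E c (n + n) JD v => blkC (matA F E c v n g)) =
      fun g => (cayRinv (LocalRing E v) (Fin n) * matA F E c v n g * cayR (LocalRing E v) (Fin n)).submatrix Sum.inr Sum.inl := by
    funext g
    have h1 := adapt_eq (matA F E c v n g)
    rw [adapt] at h1
    rw [h1]
    ext i j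
    rw [Matrix.submatrix_apply, Matrix.fromBlocks_apply₂₁]
  rw [h]
  exact ((continuous_const.matrix_mul (continuous_matA F E c v n)).matrix_mul continuous_const).matrix_submatrix _ _

/-- `g ↦ D(g)` (the adapted lower-right block) is continuous. [cite: MoeglinVignerasWaldspurger1987, Chap. 2 II.8] -/
theorem continuous_blkD_matA : Continuous fun g : UnitaryGroup.localPi E c (n + n) JD v => blkD (matA F E c v n g) := by
  have h : (fun g : UnitaryGroup.localPi E c (n + n) JD v => blkD (matA F E c v n g)) =
      fun g => (cayRinv (LocalRing E v) (Fin n) * matA F E c v n g * cayR (LocalRing E v) (Fin n)).submatrix Sum.inr Sum.inr := by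
    funext g
    have h1 := adapt_eq (matA F E c v n g)
    rw [adapt] at h1
    rw [h1]
    ext i j
    rw [Matrix.submatrix_apply, Matrix.fromBlocks_apply₂₂]
  rw [h]
  exact ((continuous_const.matrix_mul (continuous_matA F E c v n)).matrix_mul continuous_const).matrix_submatrix _ _

/-- Over a topological FIELD, `x ↦ C(x)⁻¹ D(x)` is continuous when `C, D` are and `det C(x) ≠ 0` everywhere (`C⁻¹ = det(C)⁻¹ • adj C`). [folklore] -/
theorem continuous_inv_mul_of_det_ne_zero {X K : Type*} [TopologicalSpace X] [Field K] [TopologicalSpace K] [IsTopologicalRing K] [ContinuousInv₀ K]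
    {m : Type*} [Fintype m] [DecidableEq m] {C D : X → Matrix m m K} (hC : Continuous C) (hD : Continuous D) (h0 : ∀ x, (C x).det ≠ 0) :
    Continuous fun x => (C x)⁻¹ * D x := by
  have hinv : Continuous fun x => (C x)⁻¹ := by
    have heq : (fun x => (C x)⁻¹) = fun x => ((C x).det)⁻¹ • (C x).adjugate := by
      funext x
      rw [Matrix.inv_def, Ring.inverse_eq_inv']
    rw [heq]
    exact (hC.matrix_det.inv₀ h0).smul hC.matrix_adjugate
  exact hinv.matrix_mul hD

/-- **`g ↦ C(g)⁻¹ D(g)` is continuous on the big cell `{C(g) invertible}`** (checked place by place above `v`). [cite: Kudla1994, §3] -/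
theorem continuousOn_blkCInv_mul_blkD :
    ContinuousOn (fun g : UnitaryGroup.localPi E c (n + n) JD v => (blkC (matA F E c v n g))⁻¹ * blkD (matA F E c v n g))
      {g | IsUnit (blkC (matA F E c v n g)).det} := by
  rw [continuousOn_iff_continuous_restrict]
  -- continuity into `Matrix (Fin n) (Fin n) (Π_w E_w)` is continuity of every entry at every place `w`
  refine continuous_matrix fun i j => continuous_pi fun w => ?_
  have hC : Continuous fun g : {g : UnitaryGroup.localPi E c (n + n) JD v | IsUnit (blkC (matA F E c v n g)).det} =>
      (blkC (matA F E c v n g.1)).map (Pi.evalRingHom (fun w' : PlacesOver E v => w'.1.adicCompletion E) w) :=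
    ((continuous_blkC_matA F E c v n (JD := JD)).comp continuous_subtype_val).matrix_map (continuous_apply w)
  have hD : Continuous fun g : {g : UnitaryGroup.localPi E c (n + n) JD v | IsUnit (blkC (matA F E c v n g)).det} =>
      (blkD (matA F E c v n g.1)).map (Pi.evalRingHom (fun w' : PlacesOver E v => w'.1.adicCompletion E) w) :=
    ((continuous_blkD_matA F E c v n (JD := JD)).comp continuous_subtype_val).matrix_map (continuous_apply w)
  have h0 : ∀ g : {g : UnitaryGroup.localPi E c (n + n) JD v | IsUnit (blkC (matA F E c v n g)).det},
      ((blkC (matA F E c v n g.1)).map (Pi.evalRingHom (fun w' : PlacesOver E v => w'.1.adicCompletion E) w)).det ≠ 0 :=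
    fun g => (isUnit_det_blkC_iff_forall F E c v n g.1).1 g.2 w
  refine (((continuous_inv_mul_of_det_ne_zero hC hD h0).matrix_elem i j)).congr fun g => ?_
  show (((blkC (matA F E c v n g.1)).map (Pi.evalRingHom (fun w' : PlacesOver E v => w'.1.adicCompletion E) w))⁻¹ *
      (blkD (matA F E c v n g.1)).map (Pi.evalRingHom (fun w' : PlacesOver E v => w'.1.adicCompletion E) w)) i j =
    ((blkC (matA F E c v n g.1))⁻¹ * blkD (matA F E c v n g.1)) i j w
  rw [← map_nonsing_inv_of_isUnit_det _ g.2, ← Matrix.map_mul]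
  rfl

/-! ## §2 The coordinate `ν` -/

include hcδ hδ hd hT₀ hT₀d in
/-- **THE BIG-CELL COORDINATE.**  There is `ν : H_v → H_v`, continuous on the big cell `Ω = P_Δ w_Δ N_Δ`, with `ν(p w_Δ u) = u` for `p ∈ P_Δ`, `u ∈ N_Δ` — the
`hνc`/`hν` binders of ★ `spanning_criterion` by value (`ν(g) = n(C(g)⁻¹ D(g))` on `Ω`, `1` off `Ω`).
[cite: Kudla1994, §3] [cite: HarrisKudlaSweet1996, §1 (1.11)] [cite: BernsteinZelevinsky1976, §1.5] -/
theorem exists_bigCell_coordinate [Algebra.IsQuadraticExtension F E] :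
    ∃ ν : UnitaryGroup.localPi E c (n + n) JD v → UnitaryGroup.localPi E c (n + n) JD v,
      ContinuousOn ν {g | ∃ p, IsSiegelDelta F E c hcδ hδ hd v n hT₀ hJD p ∧ ∃ u ∈ unipDeltaLocal F E c v n (JD := JD), g = p * weylDelta F E c v n hJD * u} ∧
      ∀ p, IsSiegelDelta F E c hcδ hδ hd v n hT₀ hJD p → ∀ u ∈ unipDeltaLocal F E c v n (JD := JD), ν (p * weylDelta F E c v n hJD * u) = u := by
  classical
  have hΩ : {g : UnitaryGroup.localPi E c (n + n) JD v | ∃ p, IsSiegelDelta F E c hcδ hδ hd v n hT₀ hJD p ∧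
      ∃ u ∈ unipDeltaLocal F E c v n (JD := JD), g = p * weylDelta F E c v n hJD * u} = {g | IsUnit (blkC (matA F E c v n g)).det} :=
    Set.ext fun g => mem_bigCell_iff_isUnit_det_blkC F E c hcδ hδ hd v n hT₀ hT₀d hJD g
  refine ⟨fun g => if hC : IsUnit (blkC (matA F E c v n g)).det then nElem F E c v n hJD _ (skew_blkCInv_mul_blkD F E c v n hT₀d hJD g hC) else 1, ?_, ?_⟩
  · rw [hΩ, continuousOn_iff_continuous_restrict]
    have hCD : Continuous fun g : {g : UnitaryGroup.localPi E c (n + n) JD v | IsUnit (blkC (matA F E c v n g)).det} =>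
        (⟨(blkC (matA F E c v n g.1))⁻¹ * blkD (matA F E c v n g.1), skew_blkCInv_mul_blkD F E c v n hT₀d hJD g.1 g.2⟩ :
          {t : Matrix (Fin n) (Fin n) (LocalRing E v) // (t.map (conjLocal E c v))ᵀ * gramS F E v n T₀ + gramS F E v n T₀ * t = 0}) :=
      Continuous.subtype_mk (continuousOn_iff_continuous_restrict.1 (continuousOn_blkCInv_mul_blkD F E c v n (JD := JD))) _
    refine ((continuous_nElem F E c v n hJD).comp hCD).congr fun g => ?_
    rw [Function.comp_apply, Set.restrict_apply, dif_pos (show IsUnit (blkC (matA F E c v n g.1)).det from g.2)]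
  · intro p hp u hu
    have hC : IsUnit (blkC (matA F E c v n (p * weylDelta F E c v n hJD * u))).det :=
      (mem_bigCell_iff_isUnit_det_blkC F E c hcδ hδ hd v n hT₀ hT₀d hJD _).1 ⟨p, hp, u, hu, rfl⟩
    simp only [dif_pos hC]
    exact nElem_blkCInv_mul_blkD_eq F E c hcδ hδ hd v n hT₀ hT₀d hJD hp hu hC

end Summit.HodgeConjecture.HodgeConjecture.Cruxes.HLiu418.K2LiuLocalSWBigCellCoordinate

end
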